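import Summits.MatrixMultiplication.MatrixMultiplication.Theses.SnSubsetDichotomy
-- buildfix 2026-08-20: the route decl `HyperoctahedralThreshold` (stmt-10883) was dropped at rev 5; its record lives in the
-- negative-lemma module below (namespace `…Theorems.HyperoctahedralThreshold.Negative`), opened for that one name in Edge 2.
import Summits.MatrixMultiplication.MatrixMultiplication.Theorems.HyperoctahedralThreshold.Negative.HyperoctahedralThresholdFalseOfLocalTriplePacking

/-!
# `SnSubsetDichotomy.NegativeSideResistance` — refuting any negative-side crux gives the target

Item `stmt-MatrixMultiplication-14825` (support of route `SnSubsetDichotomy`):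

  `(¬ GlobalBranch ∨ ¬ HyperoctahedralSubsets ∨ ¬ PolynomialSlack ∨ ¬ NoThresholdSubsetTriple)
     → ThresholdSubsetTriples`.

The four negative-side cruxes of the route are corollaries of `¬ ThresholdSubsetTriples`, so a
refutation of any one of them produces threshold TPP subset triples in `S_n`, i.e. the route target
(and then `closes` fires).  The four edges:

* `¬ GlobalBranch`: instantiate the refutation at `ε := 1` and simply forget the bump-freeness of
  the triple it returns (`thresholdSubsetTriples_of_not_globalBranch`).
* `¬ HyperoctahedralSubsets`: pushing the negation through the quantifiers gives literally
  `HyperoctahedralThreshold`; then forget the hosts (the content of the sibling support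
  `HyperoctahedralToThreshold`, re-proved inline in three lines to keep this file's imports to the
  route file alone).
* `¬ PolynomialSlack`: one exponent `C` and, beyond every `n₀`, a TPP triple with
  `|S||T||U|·n^C > (n!)^{3/2}`; since `n^C ≤ e^{c√n}` for all large `n`
  (`exists_rpow_le_exp_sqrt`, from `log x ≤ 4·x^{1/4}`, i.e. `Real.log_le_rpow_div`), this beats
  every threshold `(n!)^{3/2}·e^{-c√n}`.
* `¬ NoThresholdSubsetTriple`: push the negation through the quantifiers (the content of the
  sibling support `NoThresholdIffNotThreshold`), i.e. the target on the nose — done inline in the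
  final case split.

No literature facts are used; everything is elementary real analysis from Mathlib.
-/

-- `Summit.<Summit>.<Problem>` is the tree's mandated summit-side namespace; for this
-- single-conjunct summit the two coincide, so the file silences `dupNamespace`.
set_option linter.dupNamespace false

namespace Summit.MatrixMultiplication.MatrixMultiplication.Theorems

namespace NegativeSideResistance

open Summit.MatrixMultiplication.MatrixMultiplication.Theses.SnSubsetDichotomy
open Literature.Combinatorics.Additive
-- `HyperoctahedralThreshold` below = the record of the dropped route item stmt-MatrixMultiplication-10883 (ledger
-- signature verbatim) declared in `…HyperoctahedralThresholdFalseOfLocalTriplePacking`; statement texts unchanged.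
open Summit.MatrixMultiplication.MatrixMultiplication.Theorems.HyperoctahedralThreshold.Negative (HyperoctahedralThreshold)

/-! ## Edge 1: `¬ GlobalBranch` -/

/-- **Edge `¬ GlobalBranch → X`.**  A refutation of `GlobalBranch` refutes in particular its
instance at `ε := 1`; for every `c > 0` and `n₀` it therefore hands us some `n ≥ n₀` and a
(bump-free, but we forget that) TPP triple `S, T, U ⊆ S_n` violating
`|S||T||U| ≤ (n!)^{3/2}·e^{-c√n}` — a threshold triple. -/
theorem thresholdSubsetTriples_of_not_globalBranch (h : ¬ GlobalBranch) :
    ThresholdSubsetTriples := by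
  intro c hc n₀
  by_contra hcon
  refine h ⟨1, one_pos, c, hc, n₀, fun n hn S T U hTPP _ => ?_⟩
  by_contra hlt
  exact hcon ⟨n, hn, S, T, U, hTPP, lt_of_not_ge hlt⟩

/-! ## Edge 2: `¬ HyperoctahedralSubsets` -/

/-- Pushing the negation through the quantifiers: `¬ HyperoctahedralSubsets` is (literally, after
`¬ (a ≤ b) ↔ b < a`) the construction crux `HyperoctahedralThreshold`. -/
theorem hyperoctahedralThreshold_of_not_hyperoctahedralSubsets (h : ¬ HyperoctahedralSubsets) :
    HyperoctahedralThreshold := by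
  intro c hc n₀
  by_contra hcon
  refine h ⟨c, hc, n₀, fun n hn μ hμ X hX hTPP => ?_⟩
  by_contra hlt
  exact hcon ⟨n, hn, μ, hμ, X, hX, hTPP, lt_of_not_ge hlt⟩

/-- Forget the hosts: a threshold TPP triple inside three matching centralisers is a threshold TPP
triple (`HyperoctahedralThreshold → ThresholdSubsetTriples`, the sibling support
`HyperoctahedralToThreshold`, re-proved here to keep the imports minimal). -/
theorem thresholdSubsetTriples_of_hyperoctahedralThreshold (h : HyperoctahedralThreshold) :
    ThresholdSubsetTriples := by
  intro c hc n₀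
  obtain ⟨n, hn, _μ, _hμ, X, _hX, hTPP, hbig⟩ := h c hc n₀
  exact ⟨n, hn, X 0, X 1, X 2, hTPP, hbig⟩

/-- **Edge `¬ HyperoctahedralSubsets → X`**: the two previous lemmas composed. -/
theorem thresholdSubsetTriples_of_not_hyperoctahedralSubsets (h : ¬ HyperoctahedralSubsets) :
    ThresholdSubsetTriples :=
  thresholdSubsetTriples_of_hyperoctahedralThreshold
    (hyperoctahedralThreshold_of_not_hyperoctahedralSubsets h)

/-! ## Edge 3: `¬ PolynomialSlack` -/

-- adapted from Summits/MatrixMultiplication/MatrixMultiplication/Cruxes/PolynomialSlack/Disproof.lean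
-- (`exists_rpow_le_exp_sqrt`, cdisprove seat, v4 sorry-free)
/-- Polynomials are eventually below `exp (c √n)`: for `c > 0` and any real `C` there is `N` with
`n ^ C ≤ exp (c √n)` for all `n ≥ N`.  Proof: replace `C` by `C⁺ := max C 0` (monotone in the
exponent since `n ≥ 1`), write `t := n^{1/4}`, use `log n ≤ 4 t` (`Real.log_le_rpow_div` at
exponent `1/4`) and `√n = t²`; then `C⁺ log n ≤ 4 C⁺ t ≤ c t²` as soon as `t ≥ 4C⁺/c`, i.e.
`n ≥ (4C⁺/c)^4`. -/
theorem exists_rpow_le_exp_sqrt (C c : ℝ) (hc : 0 < c) :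
    ∃ N : ℕ, ∀ n : ℕ, N ≤ n → (n : ℝ) ^ C ≤ Real.exp (c * Real.sqrt n) := by
  obtain ⟨N, hN⟩ := exists_nat_ge ((4 * max C 0 / c) ^ (4 : ℝ))
  refine ⟨max N 1, fun n hn => ?_⟩
  have hn1 : (1 : ℝ) ≤ n := by exact_mod_cast (le_max_right N 1).trans hn
  have hn0 : (0 : ℝ) < n := by linarith
  have hNn : (4 * max C 0 / c) ^ (4 : ℝ) ≤ (n : ℝ) :=
    hN.trans (by exact_mod_cast (le_max_left N 1).trans hn)
  set C' : ℝ := max C 0 with hC'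
  have hC'0 : 0 ≤ C' := le_max_right _ _
  have hq0 : 0 ≤ 4 * C' / c := by positivity
  -- t := n^{1/4} ≥ 4C'/c
  set t : ℝ := (n : ℝ) ^ ((4 : ℝ)⁻¹) with ht
  have ht0 : 0 ≤ t := Real.rpow_nonneg hn0.le _
  have htq : 4 * C' / c ≤ t := by
    have h1 : ((4 * C' / c) ^ (4 : ℝ)) ^ ((4 : ℝ)⁻¹) ≤ (n : ℝ) ^ ((4 : ℝ)⁻¹) :=
      Real.rpow_le_rpow (by positivity) hNn (by norm_num)
    rwa [Real.rpow_rpow_inv hq0 (by norm_num : (4 : ℝ) ≠ 0)] at h1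
  -- log n ≤ 4 t
  have hlog : Real.log n ≤ 4 * t := by
    have h := Real.log_le_rpow_div hn0.le (by norm_num : (0 : ℝ) < 4⁻¹)
    rw [div_inv_eq_mul] at h
    linarith
  -- sqrt n = t * t
  have hsq : Real.sqrt n = t * t := by
    rw [Real.sqrt_eq_rpow, ht, ← Real.rpow_add hn0]; norm_num
  -- compare logarithms
  have hmono : (n : ℝ) ^ C ≤ (n : ℝ) ^ C' :=
    Real.rpow_le_rpow_of_exponent_le hn1 (le_max_left _ _)
  refine hmono.trans ?_
  rw [← Real.log_le_iff_le_exp (Real.rpow_pos_of_pos hn0 _), Real.log_rpow hn0, hsq]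
  have h2 : C' * Real.log n ≤ C' * (4 * t) := mul_le_mul_of_nonneg_left hlog hC'0
  have h3 : 4 * C' ≤ c * t := by
    have := mul_le_mul_of_nonneg_left htq hc.le
    rwa [mul_div_cancel₀ _ hc.ne'] at this
  nlinarith [mul_le_mul_of_nonneg_right h3 ht0]

-- adapted from Summits/MatrixMultiplication/MatrixMultiplication/Cruxes/PolynomialSlack/Disproof.lean
-- (`thresholdSubsetTriples_of_not_polynomialSlack`)
/-- **Edge `¬ PolynomialSlack → X`.**  `¬ PolynomialSlack` gives one exponent `C` and, beyond every
`n₀`, a TPP triple at some `n ≥ n₀` with `(n!)^{3/2} < |S||T||U|·n^C`; choosing `n₀` past the `N`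
of `exists_rpow_le_exp_sqrt C c` we get `(n!)^{3/2} < |S||T||U|·e^{c√n}`, i.e.
`(n!)^{3/2}·e^{-c√n} < |S||T||U|`. -/
theorem thresholdSubsetTriples_of_not_polynomialSlack (h : ¬ PolynomialSlack) :
    ThresholdSubsetTriples := by
  simp only [PolynomialSlack, not_forall, not_exists, not_le] at h
  obtain ⟨C, hC⟩ := h
  intro c hc n₀
  obtain ⟨N, hN⟩ := exists_rpow_le_exp_sqrt C c hc
  obtain ⟨n, hn, S, T, U, hTPP, hlt⟩ := hC (max n₀ N)
  refine ⟨n, (le_max_left _ _).trans hn, S, T, U, hTPP, ?_⟩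
  have hNn : N ≤ n := (le_max_right _ _).trans hn
  have hpoly := hN n hNn
  set P : ℝ := ((S.card * T.card * U.card : ℕ) : ℝ) with hP
  have hP0 : 0 ≤ P := by positivity
  have hE : 0 < Real.exp (c * Real.sqrt n) := Real.exp_pos _
  -- (n!)^{3/2} < P * n^C ≤ P * exp(c√n)
  have h1 : (n.factorial : ℝ) ^ ((3 : ℝ) / 2) < P * Real.exp (c * Real.sqrt n) :=
    hlt.trans_le (mul_le_mul_of_nonneg_left hpoly hP0)
  rw [Real.exp_neg]
  calc (n.factorial : ℝ) ^ ((3 : ℝ) / 2) * (Real.exp (c * Real.sqrt n))⁻¹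
      < P * Real.exp (c * Real.sqrt n) * (Real.exp (c * Real.sqrt n))⁻¹ :=
        mul_lt_mul_of_pos_right h1 (inv_pos.2 hE)
    _ = P := by rw [mul_inv_cancel_right₀ hE.ne']

/-! ## Edge 4: `¬ NoThresholdSubsetTriple`

This edge is pure logic — `NoThresholdSubsetTriple` is the negation of the target pushed through the
quantifiers (sibling support `NoThresholdIffNotThreshold`; also
`ThresholdSubsetTriples.Negative.threshold_of_not_noThreshold` in `Theorems/…/Negative/Packing.lean`).
It is discharged inline in the final case split below rather than restated a third time. -/

end NegativeSideResistance

/-- **Resistance of the negative side** (item `stmt-MatrixMultiplication-14825`): refuting any one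
of the route's negative-side cruxes `GlobalBranch`, `HyperoctahedralSubsets`, `PolynomialSlack`,
`NoThresholdSubsetTriple` yields threshold TPP subset triples in `S_n`, i.e. the route target
`ThresholdSubsetTriples` (whence `ω(ℂ) = 2` by the deciding theorem `closes`).  Case split on the
disjunction: the first three edges are the lemmas above, the fourth (`¬ NoThresholdSubsetTriple`,
pure logic) is discharged in place. -/
theorem negativeSideResistance_proof :
    Summit.MatrixMultiplication.MatrixMultiplication.Theses.SnSubsetDichotomy.NegativeSideResistance := by
  unfold Summit.MatrixMultiplication.MatrixMultiplication.Theses.SnSubsetDichotomy.NegativeSideResistance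
  rintro (hG | hH | hP | hN)
  · exact NegativeSideResistance.thresholdSubsetTriples_of_not_globalBranch hG
  · exact NegativeSideResistance.thresholdSubsetTriples_of_not_hyperoctahedralSubsets hH
  · exact NegativeSideResistance.thresholdSubsetTriples_of_not_polynomialSlack hP
  · -- `¬ NoThresholdSubsetTriple → X`: if no threshold triple existed beyond `n₀` at scale `c`,
    -- then `(c, n₀)` would witness `NoThresholdSubsetTriple`.
    intro c hc n₀
    by_contra hcon
    refine hN ⟨c, hc, n₀, fun n hn S T U hTPP => ?_⟩
    by_contra hlt
    exact hcon ⟨n, hn, S, T, U, hTPP, lt_of_not_ge hlt⟩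

end Summit.MatrixMultiplication.MatrixMultiplication.Theorems
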